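import Literature.NumberTheory.Automorphic.GLTwoEllipticClassTerm
import HarnessLib

/-!
# The geometric side of the `GL(2)` trace formula split into classes; the central terms
(Gelbart, *Automorphic forms on adele groups* (1975), Cor. 9.24 / (10.15): `tr R₀(Φ) =
meas(Z_𝔸 G_F \ G_𝔸) Φ(e) + Σ_{γ elliptic} meas(Z_𝔸 G(γ)_F \ G(γ)_𝔸) ∫ Φ(x⁻¹ γ x) dx`; (9.13) for the
class decomposition of the kernel)

Topic `NumberTheory/Automorphic`; theorems only (no definition, no named fact, no instance).
Companion of `GLTwoEllipticClassTerm` (the elliptic terms). Two elementary pieces of the geometric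
side of (10.15) on the non-compact quotient `X = GL₂(𝔸_K) ⧸ ℝ_{>0} GL₂(K)`, both valid for any
adelic group datum and spelled out for `AdelicGroupData.gl 2 K`:

* `lintegral_conjTsum_subgroup_eq_tsum_classes` (abstract), `glTwo_lintegral_conjTsum_eq_tsum_classes`
  — **the `[0, ∞]`-valued geometric side is the sum of its class contributions**:
  `∫_X Σ'_{γ ∈ Γ} F(x̃ γ x̃⁻¹) dμ = Σ'_{c} ∫_X Σ'_{s ∈ c} F(x̃ s x̃⁻¹) dμ` (Tonelli over the countably
  many classes; `conjTsum_subgroup_eq_tsum_conjOrbit` of `InvariantQuotientConjugacySum`). The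
  elliptic summands are evaluated by `glTwo_lintegral_conjTsum_conjOrbit_eq_covol_mul`; the
  hyperbolic and unipotent ones are the terms that Gelbart's hypothesis of Cor. 9.24 (vanishing
  unipotent averages at two places) disposes of.
* `conjTsum_conjOrbit_of_mem_center`, `lintegral_conjTsum_conjOrbit_of_mem_center` (abstract),
  `glTwo_toAdelic_mem_center_of_mem_bot`, `glTwo_centralTerm_eq` — **the central terms**: for a
  scalar `γ = c · 1 ∈ GL₂(K)` the class is `{γ}`, the class sum is the constant `F(γ)` and its
  integral is `μ(X) · F(γ)` — Gelbart's `meas(Z_𝔸 G_F \ G_𝔸) Φ(e)` (for `μ = ν/ρ_L` the total mass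
  `μ(X)` is the covolume `meas(ℝ_{>0} GL₂(K) \ GL₂(𝔸_K))`; on the quotient by `ℝ_{>0}` rather than
  by the full centre every scalar `c ∈ Kˣ` contributes such a term).

A brick of the inline (D-0026) decomposition of
`Literature.NumberTheory.Automorphic.strong_multiplicity_one_quaternionUnits` (Gelbart Thm. 10.5).

## References

* S. Gelbart, *Automorphic forms on adele groups*, Ann. of Math. Studies 83 (1975), (9.13),
  Cor. 9.24, (10.15) [Gelbart1975].
-/

noncomputable section

open scoped NNReal ENNReal
open NumberField IsDedekindDomain MeasureTheory Measure Topology Matrix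
open Literature.MeasureTheory.Group

namespace Literature.NumberTheory.Automorphic

-- the coset spaces carry Borel σ-algebras supplied locally, not the quotient σ-algebra
attribute [-instance] Quotient.instMeasurableSpace QuotientGroup.measurableSpace

/-! ### Abstract: the class decomposition under the integral, and central classes -/

section Abstract

variable {G : Type*} [Group G] [TopologicalSpace G] [IsTopologicalGroup G] [MeasurableSpace G]
  [BorelSpace G] (Γ L : Subgroup G)

/-- **The `[0, ∞]`-valued geometric side is the sum of its class contributions** (Gelbart (1975),
(9.13): the sum over `Γ` regrouped by conjugacy classes, then Tonelli over the countably many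
classes): for `L` closed, `Γ` countable with `L = Γ · C_L(Γ)`, representatives `rep`, a measure
`μ` on `G ⧸ L` and Borel `F : G → [0, ∞]`,
`∫ Σ'_{γ ∈ Γ} F(x̃ γ x̃⁻¹) dμ = Σ'_c ∫ Σ'_{s ∈ [rep c]} F(x̃ s x̃⁻¹) dμ`. [cite: Gelbart1975, (9.13)] -/
theorem lintegral_conjTsum_subgroup_eq_tsum_classes [LocallyCompactSpace G] [SecondCountableTopology G]
    [T2Space G] [hL : IsClosed (L : Set G)] [Countable Γ]
    (hLΓ : ∀ ℓ ∈ L, ∃ γ ∈ Γ, γ⁻¹ * ℓ ∈ Subgroup.centralizer (Γ : Set G))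
    (rep : ConjClasses Γ → Γ) (hrep : ∀ c, ConjClasses.mk (rep c) = c)
    [MeasurableSpace (G ⧸ L)] [BorelSpace (G ⧸ L)] (μ : Measure (G ⧸ L))
    {F : G → ℝ≥0∞} (hF : Measurable F) :
    ∫⁻ x, conjTsum L (Γ : Set G) (conj_mem_subgroup_of_exists Γ L hLΓ) F x ∂μ =
      ∑' c : ConjClasses Γ, ∫⁻ x, conjTsum L (conjOrbit Γ (rep c : G))
        (conj_mem_conjOrbit_of_exists Γ L hLΓ (rep c).2) F x ∂μ := by
  haveI := countable_conjClasses Γ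
  simp_rw [conjTsum_subgroup_eq_tsum_conjOrbit Γ L hLΓ rep hrep F]
  rw [lintegral_tsum fun c => ?_]
  haveI := countable_conjOrbit Γ (rep c : G)
  exact (measurable_conjTsum L _ _ hL hF).aemeasurable

omit [TopologicalSpace G] [IsTopologicalGroup G] [MeasurableSpace G] [BorelSpace G] in
/-- The conjugacy class of a central element of `Γ` is a singleton. [folklore] -/
theorem conjOrbit_eq_singleton_of_mem_center {γ₀ : G} (hγ₀ : γ₀ ∈ Γ)
    (hc : γ₀ ∈ Subgroup.center G) : conjOrbit Γ γ₀ = {γ₀} := by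
  ext s
  rw [mem_conjOrbit_iff, Set.mem_singleton_iff]
  have hcomm : ∀ δ : G, δ * γ₀ * δ⁻¹ = γ₀ := fun δ => by
    rw [(Subgroup.mem_center_iff.1 hc δ), mul_inv_cancel_right]
  constructor
  · rintro ⟨δ, -, rfl⟩
    exact hcomm δ
  · intro h
    rw [h]
    exact ⟨γ₀, hγ₀, hcomm γ₀⟩

omit [TopologicalSpace G] [IsTopologicalGroup G] [MeasurableSpace G] [BorelSpace G] in
/-- **The class sum of a central element is the constant `F(γ₀)`**: `Σ'_{s ∈ [γ₀]} F(x̃ s x̃⁻¹) = F(γ₀)`.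
[folklore] -/
theorem conjTsum_conjOrbit_of_mem_center {γ₀ : G} (hγ₀ : γ₀ ∈ Γ) (hc : γ₀ ∈ Subgroup.center G)
    (hS : ∀ ℓ ∈ L, ∀ s ∈ conjOrbit Γ γ₀, ℓ * s * ℓ⁻¹ ∈ conjOrbit Γ γ₀)
    {α : Type*} [AddCommMonoid α] [TopologicalSpace α] (F : G → α) (x : G ⧸ L) :
    conjTsum L (conjOrbit Γ γ₀) hS F x = F γ₀ := by
  induction x using QuotientGroup.induction_on with
  | H g =>
    rw [conjTsum_mk]
    have hmem : γ₀ ∈ conjOrbit Γ γ₀ := by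
      rw [conjOrbit_eq_singleton_of_mem_center Γ hγ₀ hc]; exact Set.mem_singleton γ₀
    have key : ∀ t : G, t ∈ conjOrbit Γ γ₀ → t = γ₀ := fun t ht => by
      rwa [conjOrbit_eq_singleton_of_mem_center Γ hγ₀ hc, Set.mem_singleton_iff] at ht
    rw [tsum_eq_single (⟨γ₀, hmem⟩ : ↥(conjOrbit Γ γ₀)) fun s hs =>
      absurd (Subtype.ext (key s.1 s.2)) hs]
    change F (g * γ₀ * g⁻¹) = F γ₀
    rw [Subgroup.mem_center_iff.1 hc g, mul_inv_cancel_right]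

omit [TopologicalSpace G] [IsTopologicalGroup G] [MeasurableSpace G] [BorelSpace G] in
/-- **The central term**: `∫_X Σ'_{s ∈ [γ₀]} F(x̃ s x̃⁻¹) dμ = F(γ₀) · μ(X)` for `γ₀ ∈ Γ` central in
`G` (Gelbart (1975), (10.15): `meas(Z_𝔸 G_F \ G_𝔸) Φ(e)`). [cite: Gelbart1975, (10.15)] -/
theorem lintegral_conjTsum_conjOrbit_of_mem_center {γ₀ : G} (hγ₀ : γ₀ ∈ Γ)
    (hc : γ₀ ∈ Subgroup.center G)
    (hS : ∀ ℓ ∈ L, ∀ s ∈ conjOrbit Γ γ₀, ℓ * s * ℓ⁻¹ ∈ conjOrbit Γ γ₀)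
    [MeasurableSpace (G ⧸ L)] (μ : Measure (G ⧸ L)) (F : G → ℝ≥0∞) :
    ∫⁻ x, conjTsum L (conjOrbit Γ γ₀) hS F x ∂μ = F γ₀ * μ Set.univ := by
  simp_rw [conjTsum_conjOrbit_of_mem_center Γ L hγ₀ hc hS F]
  rw [lintegral_const]

end Abstract

/-! ### `GL₂`: the class decomposition and the central terms -/

section GLTwo

variable (K : Type) [Field K] [NumberField K]

/-- The adelic group datum of `GL₂`. -/
local notation "G2" => AdelicGroupData.gl 2 K

attribute [local instance] AdelicGroupData.measurableSpaceQuotientForm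
  AdelicGroupData.borelSpaceQuotientForm

/-- **The geometric side of the `GL(2)` trace formula, split into conjugacy classes** (`[0, ∞]`
form; Gelbart (1975), (9.13) / (10.15)): for `𝒢 = AdelicGroupData.gl 2 K`, representatives `rep` of
the conjugacy classes of `Γ = GL₂(K)`, a Borel measure `μ` on `X = GL₂(𝔸_K) ⧸ ℝ_{>0} GL₂(K)` and
Borel `F : GL₂(𝔸_K) → [0, ∞]`,
`∫_X Σ'_{γ ∈ Γ} F(x̃ γ x̃⁻¹) dμ = Σ'_c ∫_X Σ'_{s ∈ [rep c]} F(x̃ s x̃⁻¹) dμ`. The central classes are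
evaluated by `glTwo_centralTerm_eq`, the elliptic ones by
`glTwo_lintegral_conjTsum_conjOrbit_eq_covol_mul`. [cite: Gelbart1975, (9.13) and (10.15)] -/
theorem glTwo_lintegral_conjTsum_eq_tsum_classes
    [MeasurableSpace (G2).Adelic] [BorelSpace (G2).Adelic]
    [hL : IsClosed ((G2).quotientSubgroup : Set (G2).Adelic)]
    (rep : ConjClasses (G2).arithmeticSubgroup → (G2).arithmeticSubgroup)
    (hrep : ∀ c, ConjClasses.mk (rep c) = c)
    (μ : Measure (G2).automorphicQuotient) {F : (G2).Adelic → ℝ≥0∞} (hF : Measurable F) :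
    ∫⁻ x, conjTsum (G2).quotientSubgroup ((G2).arithmeticSubgroup : Set (G2).Adelic)
        (AdelicGroupData.conj_mem_arithmeticSubgroup (G2)) F x ∂μ =
      ∑' c : ConjClasses (G2).arithmeticSubgroup,
        ∫⁻ x, conjTsum (G2).quotientSubgroup (conjOrbit (G2).arithmeticSubgroup ((rep c : (G2).arithmeticSubgroup) : (G2).Adelic))
          (conj_mem_conjOrbit_of_exists (G2).arithmeticSubgroup (G2).quotientSubgroup
            (AdelicGroupData.exists_inv_mul_mem_centralizer_quotientSubgroup (G2)) (rep c).2) F x ∂μ := by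
  haveI : Countable (G2).arithmeticSubgroup := countable_arithmeticSubgroup_glTwo K
  haveI : LocallyCompactSpace (G2).Adelic := AdelicGroupData.locallyCompactSpace_gl_adelic_holds 2 K
  haveI : SecondCountableTopology (G2).Adelic := secondCountableTopology_gl_adelic 2 K
  haveI : T2Space (G2).Adelic := t2Space_gl 2 K
  exact lintegral_conjTsum_subgroup_eq_tsum_classes (G2).arithmeticSubgroup (G2).quotientSubgroup
    (AdelicGroupData.exists_inv_mul_mem_centralizer_quotientSubgroup (G2)) rep hrep μ hF

/-- **A scalar `γ = c · 1 ∈ GL₂(K)` is central in `GL₂(𝔸_K)`** (its image is the scalar matrix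
`c`, which commutes with every matrix). [folklore] -/
theorem glTwo_toAdelic_mem_center_of_mem_bot {γ : GL (Fin 2) K}
    (hγ : (γ : Matrix (Fin 2) (Fin 2) K) ∈ (⊥ : Subalgebra K (Matrix (Fin 2) (Fin 2) K))) :
    (G2).toAdelic γ ∈ Subgroup.center (G2).Adelic := by
  obtain ⟨c, hc⟩ := Algebra.mem_bot.1 hγ
  rw [Subgroup.mem_center_iff]
  intro g
  change GL (Fin 2) (AdeleRing (𝓞 K) K) at g
  change g * Matrix.GeneralLinearGroup.map (algebraMap K (AdeleRing (𝓞 K) K)) γ =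
    Matrix.GeneralLinearGroup.map (algebraMap K (AdeleRing (𝓞 K) K)) γ * g
  refine Units.ext ?_
  rw [Units.val_mul, Units.val_mul]
  change (g : Matrix (Fin 2) (Fin 2) (AdeleRing (𝓞 K) K)) *
      (γ : Matrix (Fin 2) (Fin 2) K).map (algebraMap K (AdeleRing (𝓞 K) K)) =
    (γ : Matrix (Fin 2) (Fin 2) K).map (algebraMap K (AdeleRing (𝓞 K) K)) *
      (g : Matrix (Fin 2) (Fin 2) (AdeleRing (𝓞 K) K))
  have hmap : (γ : Matrix (Fin 2) (Fin 2) K).map (algebraMap K (AdeleRing (𝓞 K) K)) =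
      algebraMap (AdeleRing (𝓞 K) K) (Matrix (Fin 2) (Fin 2) (AdeleRing (𝓞 K) K))
        (algebraMap K (AdeleRing (𝓞 K) K) c) := by
    rw [← hc]
    ext i j
    simp [Matrix.algebraMap_matrix_apply, apply_ite (algebraMap K (AdeleRing (𝓞 K) K))]
  rw [hmap]
  exact (Algebra.commutes _ _).symm

/-- **The central terms of the `GL(2)` trace formula** (Gelbart (1975), (10.15):
`meas(Z_𝔸 G_F \ G_𝔸) Φ(e)`): for a scalar `γ = c · 1 ∈ GL₂(K)`, a measure `μ` on
`X = GL₂(𝔸_K) ⧸ ℝ_{>0} GL₂(K)` and `F : GL₂(𝔸_K) → [0, ∞]`, the class of `γ` contributes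
`∫_X Σ'_{s ∈ [γ]} F(x̃ s x̃⁻¹) dμ = F(γ) · μ(X)`. [cite: Gelbart1975, (10.15)] -/
theorem glTwo_centralTerm_eq {γ : GL (Fin 2) K}
    (hγ : (γ : Matrix (Fin 2) (Fin 2) K) ∈ (⊥ : Subalgebra K (Matrix (Fin 2) (Fin 2) K)))
    [MeasurableSpace (G2).Adelic] [BorelSpace (G2).Adelic]
    (μ : Measure (G2).automorphicQuotient) (F : (G2).Adelic → ℝ≥0∞) :
    ∫⁻ x, conjTsum (G2).quotientSubgroup (conjOrbit (G2).arithmeticSubgroup ((G2).toAdelic γ))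
        (conj_mem_conjOrbit_of_exists (G2).arithmeticSubgroup (G2).quotientSubgroup
          (AdelicGroupData.exists_inv_mul_mem_centralizer_quotientSubgroup (G2)) ⟨γ, rfl⟩) F x ∂μ =
      F ((G2).toAdelic γ) * μ Set.univ :=
  lintegral_conjTsum_conjOrbit_of_mem_center (G2).arithmeticSubgroup (G2).quotientSubgroup ⟨γ, rfl⟩
    (glTwo_toAdelic_mem_center_of_mem_bot K hγ) _ μ F

omit [NumberField K] in
/-- Every `γ ∈ GL₂(K)` is scalar, elliptic, or non-scalar with reducible characteristic polynomial
(hyperbolic or non-semisimple): the three kinds of terms of the geometric side. [folklore] -/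
theorem glTwo_class_trichotomy (γ : GL (Fin 2) K) :
    (γ : Matrix (Fin 2) (Fin 2) K) ∈ (⊥ : Subalgebra K (Matrix (Fin 2) (Fin 2) K)) ∨
      Irreducible (γ : Matrix (Fin 2) (Fin 2) K).charpoly ∨
      ((γ : Matrix (Fin 2) (Fin 2) K) ∉ (⊥ : Subalgebra K (Matrix (Fin 2) (Fin 2) K)) ∧
        ¬ Irreducible (γ : Matrix (Fin 2) (Fin 2) K).charpoly) := by
  by_cases h1 : (γ : Matrix (Fin 2) (Fin 2) K) ∈ (⊥ : Subalgebra K (Matrix (Fin 2) (Fin 2) K))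
  · exact Or.inl h1
  · by_cases h2 : Irreducible (γ : Matrix (Fin 2) (Fin 2) K).charpoly
    · exact Or.inr (Or.inl h2)
    · exact Or.inr (Or.inr ⟨h1, h2⟩)

end GLTwo

end Literature.NumberTheory.Automorphic
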